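/-
Copyright (c) 2026 the pub-hodgecm-mathlib formalisation cell (harness21).  Prover seat hodgecm-mathlib-K2Liu-p12 (g2): Track B «K2-LIT»,
#184♮ = hLiu418 = stmt-HodgeConjecture-24832; Road Φ of socket #41, organ Φ4-EXACT (LEAD F0P6-plan ruling «M-157p»), file E2c.
-/
import Summits.HodgeConjecture.HodgeConjecture.Theorems.K2LiuSkewPairingPerfect          -- ★ E2b: (N1), (N2)
import Summits.HodgeConjecture.HodgeConjecture.Theorems.K2LiuShellVanishingByAveraging   -- ★ F1: `setIntegral_eq_zero_of_translate`
import HarnessLib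

/-!
# Crux `HLiu418`, Road Φ of socket #41, organ Φ4-EXACT — FILE E2c: VANISHING OF THE DET-LEVEL CHARACTER INTEGRALS `I(k,m)`

Cell `hodgecm-mathlib`, crux item hLiu418 = `stmt-HodgeConjecture-24832`, route of record `HCCMUnconditional`; squad K2 ∕ K2Liu, road `K2_Liu`,
socket #41 `sig_K2LiuSiegelEisensteinContinuation`, Road Φ, organ Φ4-EXACT (ruling M-157p; method memo `K2/K2Liu-p12/g2/CENSUS-PHI4-EXACT-Method.K2Liu-p12-g2.md`
§1 (c)).  THEOREMS ONLY (no `def`, no `instance`, no `notation`, no named-fact hypothesis, no `sorry`); lane `--supports stmt-HodgeConjecture-24832`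
(count-neutral helper; closes no socket by itself).

THE STATEMENT (`n = 2`, unramified good place, `β` unimodular `T`-skew, `ψ_v` of conductor `0`).  The lattice integrals of ★ E1b,
  `I(k,m) = ∫_{B(−k) ∩ D(m)} ψ_v(−τ tr(βt)) dμ(t)`,  `D(m) = {t : |det t|_w ≤ |ϖ|_w^{−m} ∀ w}`,
VANISH for `1 ≤ k`, `k + 1 ≤ m` (§2: the set is invariant under translation by `S ∩ B(−1)`, on which `χ_β` is non-trivial, ★ E2b (N1), ★ F1) and for
`m = k ≥ 2` (§3: decompose `t = X + Z` along `B(−1)`; the fibre `{Z ∈ B(−1) : X + Z ∈ D(k)}` is cut out by the AFFINE-LINEAR condition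
`det X + tr(adj X·Z) ∈ ball(−k)` — the last digit — hence is stable under `{Z : tr(adj X·Z) ∈ ball(−k)}`, on which `χ_β` is non-trivial by ★ E2b (N2);
Fubini over `B(−k) × B(−1)`).  Only `I(1,1)` survives: it is the residue quadric value of E3 (inert) ∕ E4 (split).

## References
* [Shimura1997] G. Shimura, *Euler Products and Eisenstein Series*, CBMS 93 (1997), §13.5–13.6, §18.   * [Tate1950] J. Tate, thesis (1950), §2.5.
* [KudlaRallis1994] S. Kudla, S. Rallis, Ann. of Math. 140 (1994), §2.   * [Casselman1980] W. Casselman, Compositio Math. 40 (1980), §3.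
-/

set_option autoImplicit false
-- the mandated namespace repeats the single-problem summit's segment (`HodgeConjecture.HodgeConjecture`)
set_option linter.dupNamespace false

noncomputable section

open scoped NNReal ENNReal Matrix Topology
open NumberField IsDedekindDomain Matrix MeasureTheory Set Filter
open Literature.NumberTheory.Automorphic Literature.NumberTheory.Automorphic.UnitaryGroup
open Literature.NumberTheory.GaloisRepresentations.IsNonarchimedeanLocalField
open Literature.NumberTheory.GelbartRogawski1991.UnitaryDualPair.LocalSplitting
open Summit.HodgeConjecture.HodgeConjecture.Cruxes.HLiu418.K2LiuLocalRingValuationBalls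
open Summit.HodgeConjecture.HodgeConjecture.Cruxes.HLiu418.K2LiuSkewLatticeShells
open Summit.HodgeConjecture.HodgeConjecture.Cruxes.HLiu418.K2LiuShellVanishingByAveraging
open Summit.HodgeConjecture.HodgeConjecture.Cruxes.HLiu418.K2LiuWhittakerContentStrata
open Summit.HodgeConjecture.HodgeConjecture.Cruxes.HLiu418.K2LiuSkewPairingNondegeneracy
open Summit.HodgeConjecture.HodgeConjecture.Cruxes.HLiu418.K2LiuSkewPairingPerfect

namespace Summit.HodgeConjecture.HodgeConjecture.Cruxes.HLiu418.K2LiuSkewDetLevelSetVanishing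

variable (F : Type) [Field F] [NumberField F] (E : Type) [Field E] [NumberField E] [Algebra F E]
  [Algebra.IsQuadraticExtension F E] (c : E ≃ₐ[F] E) {δ : E} (hcδ : c δ = -δ) (hδ : δ ≠ 0)
  (v : HeightOneSpectrum (𝓞 F)) {π : v.adicCompletion F} (hπ : Valued.v π = WithZero.exp (-1 : ℤ))
  {T₀ : Matrix (Fin 2) (Fin 2) F} (hT₀ : T₀.IsSymm) (hT₀d : IsUnit T₀.det)

/-! ## §1 The last digit: how `det` moves under a translation -/

omit [Algebra.IsQuadraticExtension F E] in
/-- **the det level is stable under small translations**: for `X ∈ ball(−k)`, `Z` with `tr(adj X·Z) ∈ ball(−m)` and `det Z ∈ ball(−m)`: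
`det(X + Z) ∈ ball(−m) ↔ det X ∈ ball(−m)` (`det(X+Z) = det X + tr(adj X·Z) + det Z`). [cite: Shimura1997, §13.6] -/
theorem det_add_mem_ball_iff {m : ℤ} {X Z : Matrix (Fin 2) (Fin 2) (LocalRing E v)}
    (htr : ∀ w : PlacesOver E v, Valued.v (Matrix.trace (X.adjugate * Z) w) ≤ Valued.v (toPlace v w π) ^ (-m))
    (hZ : ∀ w : PlacesOver E v, Valued.v (Z.det w) ≤ Valued.v (toPlace v w π) ^ (-m)) :
    (∀ w : PlacesOver E v, Valued.v ((X + Z).det w) ≤ Valued.v (toPlace v w π) ^ (-m)) ↔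
      ∀ w : PlacesOver E v, Valued.v (X.det w) ≤ Valued.v (toPlace v w π) ^ (-m) := by
  rw [det_add_fin_two]
  constructor
  · intro h
    have h1 := ball_add F E v h (ball_neg F E v (ball_add F E v htr hZ))
    rwa [show X.det + Matrix.trace (X.adjugate * Z) + Z.det + -(Matrix.trace (X.adjugate * Z) + Z.det) = X.det by abel] at h1
  · intro h
    exact ball_add F E v (ball_add F E v h htr) hZ

include hπ in
omit [Algebra.IsQuadraticExtension F E] in
/-- `tr(adj X · Z) ∈ ball(a + b)` for `X ∈ ball a`, `Z ∈ ball b` (`2 × 2`). [folklore] -/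
theorem trace_adjugate_mul_mem_ball {a b : ℤ} {X Z : Matrix (Fin 2) (Fin 2) (LocalRing E v)}
    (hX : ∀ i j (w : PlacesOver E v), Valued.v (X i j w) ≤ Valued.v (toPlace v w π) ^ a)
    (hZ : ∀ i j (w : PlacesOver E v), Valued.v (Z i j w) ≤ Valued.v (toPlace v w π) ^ b) :
    ∀ w : PlacesOver E v, Valued.v (Matrix.trace (X.adjugate * Z) w) ≤ Valued.v (toPlace v w π) ^ (a + b) :=
  ball_trace F E v (mball_mul F E v hπ (mball_adjugate F E v hX) hZ)

/-! ## §2 `I(k,m) = 0` for `m ≥ k + 1`: translation by `S ∩ B(−1)` -/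

include hπ in
omit [Algebra.IsQuadraticExtension F E] in
/-- **`I(k,m) = 0` for `1 ≤ k`, `k + 1 ≤ m`**: the set `B(−k) ∩ D(m)` is invariant under translation by every `Z ∈ S ∩ B(−1)`
(`tr(adj X·Z) ∈ ball(−k−1) ⊆ ball(−m)`, `det Z ∈ ball(−2) ⊆ ball(−m)`), `χ_β(t + Z) = χ_β(Z)χ_β(t)`, and `χ_β(Z) ≠ 1` for some such `Z` (★ E2b (N1)).
[cite: Tate1950, §2.5] [cite: Casselman1980, §3] [cite: Shimura1997, §18] -/
theorem setIntegral_levelSet_eq_zero_of_lt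
    (S : AddSubgroup (Matrix (Fin 2) (Fin 2) (LocalRing E v)))
    (hS : ∀ t, t ∈ S ↔ (t.map (conjLocal E c v))ᵀ * gramS F E v 2 T₀ + gramS F E v 2 T₀ * t = 0)
    [MeasurableSpace S] [BorelSpace S] (μ : Measure S) [μ.IsAddHaarMeasure]
    {τ : LocalRing E v → v.adicCompletion F} (hτ : ∀ r, toLocalRing E v (τ r) = r + conjLocal E c v r)
    (hτadd : ∀ r s, τ (r + s) = τ r + τ s) (hτs : ∀ (z : v.adicCompletion F) (r : LocalRing E v), τ (toLocalRing E v z * r) = z * τ r)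
    (h2F : Valued.v (2 : v.adicCompletion F) = 1) {ψ : AddChar (v.adicCompletion F) Circle} (hdψ : ψ.HasConductorExp 0)
    {β βinv : Matrix (Fin 2) (Fin 2) (LocalRing E v)} (hβs : (β.map (conjLocal E c v))ᵀ * gramS F E v 2 T₀ + gramS F E v 2 T₀ * β = 0)
    (hββ : β * βinv = 1) (hβinv0 : ∀ i j (w : PlacesOver E v), Valued.v (βinv i j w) ≤ Valued.v (toPlace v w π) ^ (0 : ℤ))
    {k m : ℕ} (hk : 1 ≤ k) (hkm : k + 1 ≤ m) :
    ∫ t in {t : S | ∀ i j (w : PlacesOver E v), Valued.v (t.1 i j w) ≤ Valued.v (toPlace v w π) ^ (-(k : ℤ))} ∩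
        {t : S | ∀ w : PlacesOver E v, Valued.v (t.1.det w) ≤ Valued.v (toPlace v w π) ^ (-(m : ℤ))},
      ((ψ (-τ (Matrix.trace (β * t.1))) : Circle) : ℂ) ∂μ = 0 := by
  obtain ⟨Z, hZs, hZb, hne⟩ := exists_skew_mball_addChar_ne_one F E c v hπ hτ hτs h2F hdψ hβs hββ hβinv0
  set Z' : S := ⟨Z, (hS Z).2 hZs⟩ with hZ'def
  have hZk : ∀ i j (w : PlacesOver E v), Valued.v (Z i j w) ≤ Valued.v (toPlace v w π) ^ (-(k : ℤ)) :=
    mball_antitone F E v hπ (by omega) hZb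
  have hZd : ∀ w : PlacesOver E v, Valued.v (Z.det w) ≤ Valued.v (toPlace v w π) ^ (-(m : ℤ)) :=
    ball_antitone F E v hπ (by omega) (det_mem_ball_two F E v hπ hZb)
  refine setIntegral_eq_zero_of_translate μ ((measurableSet_ball F E v hπ 2 S _).inter (measurableSet_detLevel F E v hπ S _)) (t := Z')
    (fun x => ?_) (fun x _ => ?_) (ζ := ((ψ (-τ (Matrix.trace (β * Z))) : Circle) : ℂ)) (fun h => hne (Circle.coe_eq_one.1 h))
  · -- invariance of `B(−k) ∩ D(m)` under `x ↦ x + Z`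
    simp only [mem_inter_iff, mem_setOf_eq, AddSubgroup.coe_add]
    have hZneg : ∀ i j (w : PlacesOver E v), Valued.v ((-Z) i j w) ≤ Valued.v (toPlace v w π) ^ (-(k : ℤ)) := fun i j w => by
      rw [Matrix.neg_apply, Pi.neg_apply, Valuation.map_neg]; exact hZk i j w
    constructor
    · rintro ⟨hb, hd⟩
      have hxb : ∀ i j (w : PlacesOver E v), Valued.v (x.1 i j w) ≤ Valued.v (toPlace v w π) ^ (-(k : ℤ)) := by
        have h1 := mball_add F E v hb hZneg
        rwa [add_neg_cancel_right] at h1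
      refine ⟨hxb, (det_add_mem_ball_iff F E v ?_ hZd).1 hd⟩
      exact ball_antitone F E v hπ (by omega) (trace_adjugate_mul_mem_ball F E v hπ hxb hZb)
    · rintro ⟨hb, hd⟩
      refine ⟨mball_add F E v hb hZk, (det_add_mem_ball_iff F E v ?_ hZd).2 hd⟩
      exact ball_antitone F E v hπ (by omega) (trace_adjugate_mul_mem_ball F E v hπ hb hZb)
  · -- `χ_β(x + Z) = χ_β(Z) · χ_β(x)`
    rw [AddSubgroup.coe_add, Matrix.mul_add, Matrix.trace_add, hτadd, neg_add, AddChar.map_add_eq_mul, Circle.coe_mul, mul_comm]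

/-! ## §3 `I(k,k) = 0` for `k ≥ 2`: the last digit -/

include hcδ hδ hπ hT₀ hT₀d in
/-- **`I(k,k) = 0` for `k ≥ 2`.**  Fubini over `B(−k) × B(−1)`: `μ(B(−1))·I(k,k) = ∫_{X ∈ B(−k)} ∫_{Z ∈ B(−1)} 𝟙_{B(−k)∩D(k)}(X+Z) χ_β(X+Z)`, and every
fibre vanishes: `{Z ∈ B(−1) : X + Z ∈ D(k)} = {Z : det X + tr(adj X·Z) ∈ ball(−k)}` (the last digit: `det Z ∈ ball(−2) ⊆ ball(−k)`) is stable under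
`K_X = {Z ∈ B(−1) : tr(adj X·Z) ∈ ball(−k)}`, on which `χ_β` is non-trivial as soon as the fibre is non-empty (★ E2b (N2): then `|det X| ≤ |ϖ|^{−k−1}`).
[cite: Shimura1997, §13.6, §18] [cite: Tate1950, §2.5] [cite: Casselman1980, §3] -/
theorem setIntegral_levelSet_eq_zero_diag
    (S : AddSubgroup (Matrix (Fin 2) (Fin 2) (LocalRing E v)))
    (hS : ∀ t, t ∈ S ↔ (t.map (conjLocal E c v))ᵀ * gramS F E v 2 T₀ + gramS F E v 2 T₀ * t = 0)
    [MeasurableSpace S] [BorelSpace S] (μ : Measure S) [μ.IsAddHaarMeasure]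
    {τ : LocalRing E v → v.adicCompletion F} (hτ : ∀ r, toLocalRing E v (τ r) = r + conjLocal E c v r)
    (hτadd : ∀ r s, τ (r + s) = τ r + τ s) (hτs : ∀ (z : v.adicCompletion F) (r : LocalRing E v), τ (toLocalRing E v z * r) = z * τ r)
    (hτc : Continuous τ) (h2F : Valued.v (2 : v.adicCompletion F) = 1)
    (hTb : ∀ i j (w : PlacesOver E v), Valued.v (gramS F E v 2 T₀ i j w) ≤ Valued.v (toPlace v w π) ^ (0 : ℤ))
    (hTib : ∀ i j (w : PlacesOver E v), Valued.v ((gramS F E v 2 T₀)⁻¹ i j w) ≤ Valued.v (toPlace v w π) ^ (0 : ℤ))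
    {ε : LocalRing E v} (hεσ : conjLocal E c v ε = -ε) (hεint : ∀ w : PlacesOver E v, Valued.v (ε w) ≤ 1)
    (hε : ∀ w : PlacesOver E v, Valued.v (toPlace v w π) ^ (0 : ℤ) ≤ Valued.v ((2 * ε) w))
    (h2 : ∀ w : PlacesOver E v, Valued.v (toPlace v w π) ^ (0 : ℤ) ≤ Valued.v ((2 : LocalRing E v) w))
    {ψ : AddChar (v.adicCompletion F) Circle} (hψ : Continuous ψ) (hdψ : ψ.HasConductorExp 0)
    {β βinv : Matrix (Fin 2) (Fin 2) (LocalRing E v)} (hβs : (β.map (conjLocal E c v))ᵀ * gramS F E v 2 T₀ + gramS F E v 2 T₀ * β = 0)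
    (hββ : β * βinv = 1) (hβ0 : ∀ i j (w : PlacesOver E v), Valued.v (β i j w) ≤ Valued.v (toPlace v w π) ^ (0 : ℤ))
    (hβinv0 : ∀ i j (w : PlacesOver E v), Valued.v (βinv i j w) ≤ Valued.v (toPlace v w π) ^ (0 : ℤ))
    {k : ℕ} (hk : 2 ≤ k) :
    ∫ t in {t : S | ∀ i j (w : PlacesOver E v), Valued.v (t.1 i j w) ≤ Valued.v (toPlace v w π) ^ (-(k : ℤ))} ∩
        {t : S | ∀ w : PlacesOver E v, Valued.v (t.1.det w) ≤ Valued.v (toPlace v w π) ^ (-(k : ℤ))},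
      ((ψ (-τ (Matrix.trace (β * t.1))) : Circle) : ℂ) ∂μ = 0 := by
  -- second countability (for `MeasurableAdd₂ S`)
  haveI : ∀ w : PlacesOver E v, SecondCountableTopology (w.1.adicCompletion E) := fun w => secondCountableTopology_localField _
  haveI hsc : SecondCountableTopology (Fin 2 → Fin 2 → LocalRing E v) := inferInstance
  haveI : SecondCountableTopology (Matrix (Fin 2) (Fin 2) (LocalRing E v)) := hsc
  haveI : SecondCountableTopology S := TopologicalSpace.Subtype.secondCountableTopology _
  -- the sets and the character
  set Bk : Set S := {t : S | ∀ i j (w : PlacesOver E v), Valued.v (t.1 i j w) ≤ Valued.v (toPlace v w π) ^ (-(k : ℤ))} with hBkdef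
  set Dk : Set S := {t : S | ∀ w : PlacesOver E v, Valued.v (t.1.det w) ≤ Valued.v (toPlace v w π) ^ (-(k : ℤ))} with hDkdef
  set H : Set S := {t : S | ∀ i j (w : PlacesOver E v), Valued.v (t.1 i j w) ≤ Valued.v (toPlace v w π) ^ (-(1 : ℤ))} with hHdef
  set g : S → ℂ := fun t => ((ψ (-τ (Matrix.trace (β * t.1))) : Circle) : ℂ) with hgdef
  have hBkm : MeasurableSet Bk := measurableSet_ball F E v hπ 2 S _
  have hDkm : MeasurableSet Dk := measurableSet_detLevel F E v hπ S _
  have hHm : MeasurableSet H := measurableSet_ball F E v hπ 2 S _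
  have hΩm : MeasurableSet (Bk ∩ Dk) := hBkm.inter hDkm
  have hBkμ : μ Bk ≠ ∞ := measure_ball_ne_top F E c v hπ 2 S hS μ _
  have hHμ : μ H ≠ ∞ := measure_ball_ne_top F E c v hπ 2 S hS μ _
  have hH0 : μ H ≠ 0 := measure_ball_ne_zero F E c v hπ 2 S hS μ _
  have hHB : H ⊆ Bk := ball_antitone F E v hπ 2 S (by omega)
  have hgc : Continuous g :=
    continuous_subtype_val.comp (hψ.comp (hτc.comp (continuous_const.matrix_mul continuous_subtype_val).matrix_trace).neg)
  have hgm : Measurable g := hgc.measurable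
  have hg1 : ∀ t, ‖g t‖ ≤ 1 := fun t => by rw [hgdef, Circle.norm_coe]
  have hgadd : ∀ x z : S, g (x + z) = g x * g z := fun x z => by
    simp only [hgdef, AddSubgroup.coe_add, Matrix.mul_add, Matrix.trace_add, hτadd, neg_add, AddChar.map_add_eq_mul, Circle.coe_mul]
  -- §3.1 every fibre vanishes
  have hfib : ∀ X : S, ∫ Z in H, (Bk ∩ Dk).indicator g (X + Z) ∂μ = 0 := by
    intro X
    set FX : Set S := (fun Z : S => X + Z) ⁻¹' (Bk ∩ Dk) with hFXdef
    have hFXm : MeasurableSet FX := (measurable_const_add X) hΩm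
    have hind : (fun Z : S => (Bk ∩ Dk).indicator g (X + Z)) = FX.indicator fun Z => g (X + Z) := by
      funext Z
      by_cases hZ : X + Z ∈ Bk ∩ Dk
      · rw [indicator_of_mem hZ, indicator_of_mem (show Z ∈ FX from hZ)]
      · rw [indicator_of_notMem hZ, indicator_of_notMem (show Z ∉ FX from hZ)]
    rw [hind, setIntegral_indicator hFXm]
    simp_rw [hgadd X]
    rw [integral_const_mul]
    refine mul_eq_zero_of_right _ ?_
    by_cases hne : (H ∩ FX).Nonempty
    · obtain ⟨Z₀, hZ₀H, hZ₀F⟩ := hne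
      obtain ⟨hXZb, hXZd⟩ : X + Z₀ ∈ Bk ∩ Dk := hZ₀F
      -- `X ∈ B(−k)` and `|det X| ≤ |ϖ|^{−k−1}`
      have hZ₀k : ∀ i j (w : PlacesOver E v), Valued.v (Z₀.1 i j w) ≤ Valued.v (toPlace v w π) ^ (-(k : ℤ)) := hHB hZ₀H
      have hZ₀neg : ∀ i j (w : PlacesOver E v), Valued.v ((-Z₀.1) i j w) ≤ Valued.v (toPlace v w π) ^ (-(k : ℤ)) := fun i j w => by
        rw [Matrix.neg_apply, Pi.neg_apply, Valuation.map_neg]; exact hZ₀k i j w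
      have hXb : ∀ i j (w : PlacesOver E v), Valued.v (X.1 i j w) ≤ Valued.v (toPlace v w π) ^ (-(k : ℤ)) := by
        have hXZb' : ∀ i j (w : PlacesOver E v), Valued.v ((X.1 + Z₀.1) i j w) ≤ Valued.v (toPlace v w π) ^ (-(k : ℤ)) := by
          intro i j w; have h := hXZb i j w; rwa [AddSubgroup.coe_add] at h
        have h1 := mball_add F E v hXZb' hZ₀neg
        rwa [add_neg_cancel_right] at h1
      have hXd : ∀ w : PlacesOver E v, Valued.v (X.1.det w) ≤ Valued.v (toPlace v w π) ^ (-(k : ℤ) - 1) := by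
        have htr : ∀ w : PlacesOver E v, Valued.v (Matrix.trace (X.1.adjugate * Z₀.1) w) ≤ Valued.v (toPlace v w π) ^ (-((k : ℤ) + 1)) := by
          have h1 := trace_adjugate_mul_mem_ball F E v hπ hXb hZ₀H
          rwa [show -(k : ℤ) + -(1 : ℤ) = -((k : ℤ) + 1) by ring] at h1
        have hdZ : ∀ w : PlacesOver E v, Valued.v (Z₀.1.det w) ≤ Valued.v (toPlace v w π) ^ (-((k : ℤ) + 1)) :=
          ball_antitone F E v hπ (by omega) (det_mem_ball_two F E v hπ hZ₀H)
        have hsum : ∀ w : PlacesOver E v, Valued.v ((X.1 + Z₀.1).det w) ≤ Valued.v (toPlace v w π) ^ (-((k : ℤ) + 1)) := by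
          have h1 : ∀ w : PlacesOver E v, Valued.v ((X + Z₀).1.det w) ≤ Valued.v (toPlace v w π) ^ (-(k : ℤ)) := hXZd
          rw [AddSubgroup.coe_add] at h1
          exact ball_antitone F E v hπ (by omega) h1
        have h := (det_add_mem_ball_iff F E v htr hdZ).1 hsum
        rwa [show -((k : ℤ) + 1) = -(k : ℤ) - 1 by ring] at h
      obtain ⟨Z₁, hZ₁s, hZ₁b, hZ₁tr, hne1⟩ := exists_fibre_addChar_ne_one F E c hcδ hδ v hπ hT₀ hT₀d hτ hτadd hτs h2F hTb hTib hεσ hεint hε h2 hdψ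
        hβs hββ hβ0 hβinv0 hk ((hS X.1).1 X.2) hXb hXd
      set Z₁' : S := ⟨Z₁, (hS Z₁).2 hZ₁s⟩ with hZ₁'def
      refine setIntegral_eq_zero_of_translate μ (hHm.inter hFXm) (t := Z₁') (fun Z => ?_) (fun Z _ => by rw [hgadd, mul_comm])
        (ζ := g Z₁') (fun h => hne1 (Circle.coe_eq_one.1 h))
      -- invariance of the fibre under `Z ↦ Z + Z₁`
      have hstep : ∀ (Z : S), Z ∈ H → (X + (Z + Z₁') ∈ Bk ∩ Dk ↔ X + Z ∈ Bk ∩ Dk) := by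
        intro Z hZH
        have hZk : ∀ i j (w : PlacesOver E v), Valued.v (Z.1 i j w) ≤ Valued.v (toPlace v w π) ^ (-(k : ℤ)) := hHB hZH
        have hZ₁k : ∀ i j (w : PlacesOver E v), Valued.v (Z₁ i j w) ≤ Valued.v (toPlace v w π) ^ (-(k : ℤ)) := mball_antitone F E v hπ (by omega) hZ₁b
        have hXZ : ∀ i j (w : PlacesOver E v), Valued.v ((X.1 + Z.1) i j w) ≤ Valued.v (toPlace v w π) ^ (-(k : ℤ)) := mball_add F E v hXb hZk
        have hXZZ : ∀ i j (w : PlacesOver E v), Valued.v ((X.1 + (Z.1 + Z₁)) i j w) ≤ Valued.v (toPlace v w π) ^ (-(k : ℤ)) :=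
          mball_add F E v hXb (mball_add F E v hZk hZ₁k)
        -- the last digit: `tr(adj(X+Z)·Z₁) = tr(adj X·Z₁) + tr(adj Z·Z₁) ∈ ball(−k)`, `det Z₁ ∈ ball(−2) ⊆ ball(−k)`
        have hadj : (X.1 + Z.1).adjugate = X.1.adjugate + Z.1.adjugate := by
          rw [adjugate_eq_trace_smul_sub, adjugate_eq_trace_smul_sub, adjugate_eq_trace_smul_sub, Matrix.trace_add, add_smul]; abel
        have htr : ∀ w : PlacesOver E v, Valued.v (Matrix.trace ((X.1 + Z.1).adjugate * Z₁) w) ≤ Valued.v (toPlace v w π) ^ (-(k : ℤ)) := by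
          rw [hadj, Matrix.add_mul, Matrix.trace_add]
          exact ball_add F E v hZ₁tr (ball_antitone F E v hπ (by omega) (trace_adjugate_mul_mem_ball F E v hπ hZH hZ₁b))
        have hdZ₁ : ∀ w : PlacesOver E v, Valued.v (Z₁.det w) ≤ Valued.v (toPlace v w π) ^ (-(k : ℤ)) :=
          ball_antitone F E v hπ (by omega) (det_mem_ball_two F E v hπ hZ₁b)
        simp only [mem_inter_iff, hBkdef, hDkdef, mem_setOf_eq, AddSubgroup.coe_add]
        rw [show X.1 + (Z.1 + Z₁) = (X.1 + Z.1) + Z₁ by abel]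
        constructor
        · rintro ⟨-, hd⟩; exact ⟨hXZ, (det_add_mem_ball_iff F E v htr hdZ₁).1 hd⟩
        · rintro ⟨-, hd⟩
          refine ⟨by rw [← add_assoc] at hXZZ; exact hXZZ, (det_add_mem_ball_iff F E v htr hdZ₁).2 hd⟩
      have hHstab : ∀ Z : S, Z + Z₁' ∈ H ↔ Z ∈ H := fun Z => by
        simp only [hHdef, mem_setOf_eq, AddSubgroup.coe_add]
        have hZ₁neg : ∀ i j (w : PlacesOver E v), Valued.v ((-Z₁) i j w) ≤ Valued.v (toPlace v w π) ^ (-(1 : ℤ)) := fun i j w => by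
          rw [Matrix.neg_apply, Pi.neg_apply, Valuation.map_neg]; exact hZ₁b i j w
        constructor
        · intro h
          have h1 := mball_add F E v h hZ₁neg
          rwa [add_neg_cancel_right] at h1
        · intro h; exact mball_add F E v h hZ₁b
      simp only [mem_inter_iff, hFXdef, mem_preimage]
      constructor
      · rintro ⟨hH', hF'⟩
        have hZH := (hHstab Z).1 hH'
        exact ⟨hZH, (hstep Z hZH).1 hF'⟩
      · rintro ⟨hZH, hF'⟩
        exact ⟨(hHstab Z).2 hZH, (hstep Z hZH).2 hF'⟩
    · rw [not_nonempty_iff_eq_empty] at hne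
      rw [hne, Measure.restrict_empty, integral_zero_measure]
  -- §3.2 Fubini: `μ(H) · I = ∫_{X ∈ B(−k)} (fibre integral) = 0`
  have hI : (μ.real H : ℂ) * ∫ t in Bk ∩ Dk, g t ∂μ = ∫ X in Bk, (∫ Z in H, (Bk ∩ Dk).indicator g (X + Z) ∂μ) ∂μ := by
    haveI : IsFiniteMeasure (μ.restrict Bk) := isFiniteMeasure_restrict.2 hBkμ
    haveI : IsFiniteMeasure (μ.restrict H) := isFiniteMeasure_restrict.2 hHμ
    -- translation invariance on `B(−k)`: for `Z ∈ H`, `∫_{X ∈ Bk} 𝟙_Ω g (X + Z) = ∫_Ω g`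
    have htrans : ∀ Z ∈ H, ∫ X in Bk, (Bk ∩ Dk).indicator g (X + Z) ∂μ = ∫ t in Bk ∩ Dk, g t ∂μ := by
      intro Z hZ
      have hZneg : ∀ i j (w : PlacesOver E v), Valued.v ((-Z.1) i j w) ≤ Valued.v (toPlace v w π) ^ (-(k : ℤ)) := fun i j w => by
        rw [Matrix.neg_apply, Pi.neg_apply, Valuation.map_neg]; exact hHB hZ i j w
      have hBkZ : ∀ X : S, X + Z ∈ Bk ↔ X ∈ Bk := fun X => by
        simp only [hBkdef, mem_setOf_eq, AddSubgroup.coe_add]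
        constructor
        · intro h
          have h1 := mball_add F E v h hZneg
          rwa [add_neg_cancel_right] at h1
        · intro h; exact mball_add F E v h (hHB hZ)
      have h1 : ∫ X in Bk, (Bk ∩ Dk).indicator g (X + Z) ∂μ = ∫ X, (Bk ∩ Dk).indicator g (X + Z) ∂μ := by
        rw [← integral_indicator hBkm]
        refine integral_congr_ae (Eventually.of_forall fun X => ?_)
        change Bk.indicator (fun X => (Bk ∩ Dk).indicator g (X + Z)) X = (Bk ∩ Dk).indicator g (X + Z)
        by_cases hX : X ∈ Bk
        · rw [indicator_of_mem hX]
        · rw [indicator_of_notMem hX, indicator_of_notMem (show X + Z ∉ Bk ∩ Dk from fun h => hX ((hBkZ X).1 h.1))]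
      rw [h1, integral_add_right_eq_self (fun X => (Bk ∩ Dk).indicator g X) Z, integral_indicator hΩm]
    -- the swap
    have hGm : Measurable fun p : S × S => (Bk ∩ Dk).indicator g (p.1 + p.2) := (hgm.indicator hΩm).comp measurable_add
    have hGint : Integrable (Function.uncurry fun X Z => (Bk ∩ Dk).indicator g (X + Z)) ((μ.restrict Bk).prod (μ.restrict H)) := by
      refine Integrable.of_bound hGm.aestronglyMeasurable 1 (Eventually.of_forall fun p => ?_)
      change ‖(Bk ∩ Dk).indicator g (p.1 + p.2)‖ ≤ 1
      exact (norm_indicator_le_norm_self _ _).trans (hg1 _)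
    calc (μ.real H : ℂ) * ∫ t in Bk ∩ Dk, g t ∂μ = ∫ _ in H, (∫ t in Bk ∩ Dk, g t ∂μ) ∂μ := by
          rw [setIntegral_const, Complex.real_smul]
      _ = ∫ Z in H, (∫ X in Bk, (Bk ∩ Dk).indicator g (X + Z) ∂μ) ∂μ := (setIntegral_congr_fun hHm fun Z hZ => (htrans Z hZ).symm)
      _ = ∫ X in Bk, (∫ Z in H, (Bk ∩ Dk).indicator g (X + Z) ∂μ) ∂μ := (integral_integral_swap hGint).symm
  have hzero : ∫ X in Bk, (∫ Z in H, (Bk ∩ Dk).indicator g (X + Z) ∂μ) ∂μ = 0 := by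
    rw [setIntegral_congr_fun hBkm (fun X _ => hfib X), integral_zero]
  rw [hzero] at hI
  have hHr : (μ.real H : ℂ) ≠ 0 := by
    rw [Ne, Complex.ofReal_eq_zero, measureReal_def, ENNReal.toReal_eq_zero_iff, not_or]
    exact ⟨hH0, hHμ⟩
  exact (mul_eq_zero.1 hI).resolve_left hHr

end Summit.HodgeConjecture.HodgeConjecture.Cruxes.HLiu418.K2LiuSkewDetLevelSetVanishing

end
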